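import Summits.RiemannHypothesis.RiemannHypothesis.Theorems.Splittings.BombieriTruncSynthesis
import Summits.RiemannHypothesis.RiemannHypothesis.Theorems.Splittings.NearLatticeFourierSynthesis
import Literature.NumberTheory.LFunctions.LittlewoodZeroGaps

/-!
# Splittings — x-wuc (xiv-d4): (T7) the KERNEL REDUCTION `synthesisScreening_of : ZeroOrdinateGapsShrink → NearLatticeSynthesis → SynthesisScreening`, with PA discharged

Cell rh-split, seat rh-split-x-wuc g6/g7 (brief sha16 f79c5f09d8bcb036), card `run/shared/lean/pub/rh-split/cards/SPLIT-x-wuc.md`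
§12–§13 (scratch of record `HOME/rh-split-x-wuc/SplitXWucG7b.lean` sha16 d0583c86bc2d8ec7: farm `lean check` rc 0 · 0 sorry · 0 warning,
standard axioms; referee replays: see the card).  Carved VERBATIM from that scratch by `HOME/rh-split-x-wuc/cut7/make_cut7.py`
(cut (xiv-d), deltas listed in `cut7/CUT7.md`); sections as numbered there.
* G7.4 the two named inputs `ZeroOrdinateGapsShrink` (D5′ = the Literature named fact `littlewood_zero_ordinate_gaps_shrink`, bridged) and
  `NearLatticeSynthesis` (PA, PROVED: bridge `nearLatticeSynthesis` to `Splittings.NearLatticeFourierSynthesis`); G7.5 conjugation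
  symmetry of the zeros and a HIGH off-line zero from `¬FOZ`; G7.6 **(T7) `synthesisScreening_of`** — choice of a high off-line zero, the
  near-lattice / hole DICHOTOMY, case A by T7a + PA, case B by the gaps fact + `offLine_sparse_of_boundedAway` — all KERNEL.
  Net: `SynthesisScreening` (hence row X-6) holds modulo Littlewood's gap theorem (print) alone.
HONEST LABEL: «SPLITTING SEARCH over kernel-typed RH-EQUIVALENCES; a splitting A ∧ B ⟹ RH is CONDITIONAL bookkeeping
unless A and B are both proved; nothing here bears on the truth of RH.»
-/

set_option linter.dupNamespace false

noncomputable section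

open scoped Classical ComplexConjugate
open Set Filter Topology Complex MeasureTheory

namespace Summit.RiemannHypothesis.RiemannHypothesis.Theorems.Splittings.BombieriTruncSynthesisScreening

open Literature.NumberTheory.LFunctions Literature.NumberTheory.LFunctions.Bombieri2000
open Summit.RiemannHypothesis.RiemannHypothesis.Theses.RuelleBand
open Summit.RiemannHypothesis.RiemannHypothesis.Theorems.Splittings.BombieriTruncEigen
open Summit.RiemannHypothesis.RiemannHypothesis.Theorems.Splittings.BombieriFozNoDep
open Summit.RiemannHypothesis.RiemannHypothesis.Theorems.Splittings.BombieriTruncGram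
open Summit.RiemannHypothesis.RiemannHypothesis.Theorems.Splittings.BombieriTruncPairing
open Summit.RiemannHypothesis.RiemannHypothesis.Theorems.Splittings.BombieriTruncScreening
open Summit.RiemannHypothesis.RiemannHypothesis.Theorems.Splittings.BombieriTruncBandGap
open Summit.RiemannHypothesis.RiemannHypothesis.Theorems.Splittings.BombieriTruncMultiplicity
open Summit.RiemannHypothesis.RiemannHypothesis.Theorems.Splittings.BombieriTruncEventualStrip
open Summit.RiemannHypothesis.RiemannHypothesis.Theorems.Splittings.BombieriTruncExactness
open Summit.RiemannHypothesis.RiemannHypothesis.Theorems.Splittings.BombieriTruncClump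
open Summit.RiemannHypothesis.RiemannHypothesis.Theorems.Splittings.BombieriTruncOffLineSparse
open Summit.RiemannHypothesis.RiemannHypothesis.Theorems.Splittings.BombieriTruncSynthesis

variable {N : ℕ}

/-! ### G7.4 The two named inputs of the reduction -/

/-- **D5′ — ZERO ORDINATES BECOME DENSE** (qualitative form of Littlewood 1924; Titchmarsh, *The theory of the Riemann
zeta-function*, 2nd ed., Thm 9.12: «for every large `T`, `ζ` has a zero `β + iγ` with `|γ − T| < A / log log log T`»).
PRINT-WITH-PROOF; the tree's named fact is `Literature.NumberTheory.LFunctions.littlewood_zero_ordinate_gaps_shrink` (the same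
statement token for token; bridge `zeroOrdinateGapsShrink_of_littlewood` below); used hypothesis-only, never asserted.
[print: Titchmarsh1986 Thm 9.12; Littlewood 1924] -/
def ZeroOrdinateGapsShrink : Prop :=
  ∀ ε : ℝ, 0 < ε → ∃ T₁ : ℝ, ∀ T : ℝ, T₁ ≤ T →
    ∃ ρ ∈ ZetaZeros.riemannZetaNontrivialZeros, |ρ.im - T| ≤ ε

/-- **PA — NEAR-LATTICE SYNTHESIS of `2 sinh(κu)` on `[−1,1]`** (ζ-FREE; a statement about finite exponential sums only).
For every multiplicity cap `M` and every `c > 0` there are a lattice step `H`, a half-width `K₀` and a tolerance `θ`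
such that for every `|κ| < ½` and every `θH`-perturbation `λ` of the lattice `H·{−K₀,…,K₀}` some coefficients `b` achieve
`∫_{[−1,1]} |2 sinh(κu) − Σ_k b_k e^{−iλ_k u}|² du + c·Σ_k |b_k|² < 2c/M`.
PROVED: `Splittings.NearLatticeFourierSynthesis.nearLatticeSynthesis` (the same statement token for token; Fourier series
of the monomial targets on a long period, Taylor expansion in `κ`, lattice perturbation `|e^{−iλu} − e^{−ikHu}| ≤ θH|u|`), bridged below by
`nearLatticeSynthesis`; kept as a named Prop because (T7) `synthesisScreening_of` is stated over it.  Replaces the Kadec-¼ + compactness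
step (T6a-2/3) of the card's paper theorem 12b. [cell lemma; kernel] -/
def NearLatticeSynthesis : Prop :=
  ∀ (M : ℕ) (c : ℝ), 0 < M → 0 < c →
    ∃ (K₀ : ℕ) (H θ : ℝ), 0 < H ∧ 0 < θ ∧ θ < 1 / 2 ∧ θ * H ≤ 1 / 2 ∧
      ∀ κ : ℝ, |κ| < 1 / 2 → ∀ lam : ℤ → ℝ,
        (∀ k ∈ Finset.Icc (-(K₀ : ℤ)) K₀, |lam k - k * H| ≤ θ * H) →
        ∃ b : ℤ → ℂ,
          (∫ u in Icc (-1 : ℝ) 1,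
              ‖2 * (Real.sinh (κ * u) : ℂ) - ∑ k ∈ Finset.Icc (-(K₀ : ℤ)) K₀, b k * cexp (-(I * lam k * u))‖ ^ 2)
            + c * ∑ k ∈ Finset.Icc (-(K₀ : ℤ)) K₀, ‖b k‖ ^ 2 < 2 * c / M

/-- Bridge D5′: the Literature named fact `littlewood_zero_ordinate_gaps_shrink` [cite: Titchmarsh1986, Thm 9.12] IS `ZeroOrdinateGapsShrink`. -/
theorem zeroOrdinateGapsShrink_of_littlewood (h : Literature.NumberTheory.LFunctions.littlewood_zero_ordinate_gaps_shrink) :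
    ZeroOrdinateGapsShrink := h

/-- **PA in kernel:** `NearLatticeSynthesis` holds (`Splittings.NearLatticeFourierSynthesis.nearLatticeSynthesis`). [KERNEL; ζ-free] -/
theorem nearLatticeSynthesis : NearLatticeSynthesis :=
  Summit.RiemannHypothesis.RiemannHypothesis.Theorems.Splittings.NearLatticeFourierSynthesis.nearLatticeSynthesis

/-! ### G7.5 Zeros: conjugation symmetry and a HIGH off-line zero from `¬FOZ` -/

/-- The set of non-trivial zeros of `ζ` is closed under complex conjugation. -/
private theorem conj_mem_ntz {ρ : ℂ} (h : ρ ∈ ZetaZeros.riemannZetaNontrivialZeros) :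
    conj ρ ∈ ZetaZeros.riemannZetaNontrivialZeros := by
  obtain ⟨h0, h1, h2⟩ := mem_riemannZetaNontrivialZeros_iff_holds.1 h
  refine mem_riemannZetaNontrivialZeros_iff_holds.2 ⟨?_, by simpa using h1, by simpa using h2⟩
  rw [riemannZeta_conj, h0, map_zero]

/-- The non-trivial zeros in a bounded region `‖ρ − ½‖ ≤ R` form a finite set (every zero has a slot; `trunc_finite`). -/
theorem finite_ntz_ball (R : ℝ) :
    {ρ : ℂ | ρ ∈ ZetaZeros.riemannZetaNontrivialZeros ∧ ‖ρ - 1 / 2‖ ≤ R}.Finite := by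
  refine ((ZeroIdx.trunc_finite R).image ZeroIdx.val).subset fun ρ hρ ↦ ?_
  obtain ⟨i, hi⟩ := exists_slot hρ.1
  exact ⟨i, by rw [ZeroIdx.trunc, Set.mem_setOf_eq, hi]; exact hρ.2, hi⟩

/-- From `¬FOZ`: off-line zeros RIGHT of the line at arbitrarily LARGE POSITIVE height. -/
theorem exists_offLine_high (h : ¬ CofiniteCriticalLine) (T : ℝ) :
    ∃ ρ ∈ ZetaZeros.riemannZetaNontrivialZeros, 1 / 2 < ρ.re ∧ T ≤ ρ.im := by
  rw [cofiniteCriticalLine_iff_foz] at h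
  have hinf : ({ρ : ℂ | ρ ∈ ZetaZeros.riemannZetaNontrivialZeros ∧ ρ.re ≠ 1 / 2} \
      {ρ : ℂ | ρ ∈ ZetaZeros.riemannZetaNontrivialZeros ∧ ‖ρ - 1 / 2‖ ≤ |T| + 1}).Infinite :=
    Set.Infinite.sdiff h (finite_ntz_ball _)
  obtain ⟨ρ, ⟨hρ, hre⟩, hfar⟩ := hinf.nonempty
  have hfar' : |T| + 1 < ‖ρ - 1 / 2‖ := by
    by_contra hle
    exact hfar ⟨hρ, not_lt.1 hle⟩
  obtain ⟨_, h0, h1⟩ := mem_riemannZetaNontrivialZeros_iff_holds.1 hρ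
  have him : |T| < |ρ.im| := by
    have hn : ‖ρ - 1 / 2‖ ≤ |(ρ - 1 / 2).re| + |(ρ - 1 / 2).im| := Complex.norm_le_abs_re_add_abs_im _
    have hre' : |(ρ - 1 / 2).re| ≤ 1 := by
      rw [abs_le]
      simp only [Complex.sub_re, Complex.div_ofNat_re, Complex.one_re]
      constructor <;> linarith
    have him' : (ρ - 1 / 2).im = ρ.im := by simp
    rw [him'] at hn
    linarith
  -- step 1: positive height (conjugate if needed)
  obtain ⟨ρ₁, hρ₁, hre₁, him₁⟩ : ∃ ρ₁ ∈ ZetaZeros.riemannZetaNontrivialZeros, ρ₁.re = ρ.re ∧ ρ₁.im = |ρ.im| := by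
    by_cases hs : 0 ≤ ρ.im
    · exact ⟨ρ, hρ, rfl, (abs_of_nonneg hs).symm⟩
    · exact ⟨conj ρ, conj_mem_ntz hρ, by simp, by rw [Complex.conj_im, abs_of_neg (not_le.1 hs)]⟩
  -- step 2: right of the line (mirror `1 − ρ̄` if needed)
  obtain ⟨ρ₂, hρ₂, hre₂, him₂⟩ : ∃ ρ₂ ∈ ZetaZeros.riemannZetaNontrivialZeros, 1 / 2 < ρ₂.re ∧ ρ₂.im = ρ₁.im := by
    by_cases hs : 1 / 2 < ρ₁.re
    · exact ⟨ρ₁, hρ₁, hs, rfl⟩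
    · refine ⟨1 - conj ρ₁, ZeroIdx.one_sub_conj_mem hρ₁, ?_, by simp⟩
      have hne : ρ₁.re ≠ 1 / 2 := by rw [hre₁]; exact hre
      have hlt : ρ₁.re < 1 / 2 := lt_of_le_of_ne (not_lt.1 hs) hne
      simp only [Complex.sub_re, Complex.one_re, Complex.conj_re]
      linarith
  refine ⟨ρ₂, hρ₂, hre₂, ?_⟩
  rw [him₂, him₁]
  exact (le_abs_self T).trans him.le

/-! ### G7.6 (T7) The KERNEL REDUCTION of the paper theorem X-6 to D5′ + PA -/

/-- Integer lattice sites at real distance `< 1` coincide. -/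
private theorem int_eq_of_abs_sub_lt_one {k l : ℤ} (h : |(k : ℝ) - l| < 1) : k = l := by
  have h' : |k - l| < (1 : ℤ) := by exact_mod_cast h
  exact sub_eq_zero.1 (Int.abs_lt_one_iff.1 h')

/-- **(T7) `SynthesisScreening` FROM the gaps fact D5′ and the ζ-free synthesis lemma PA** (kernel; the complete ζ/matrix
bookkeeping of the card's paper theorem 12b).  PROOF.  Let `M` bound the off-line multiplicities, assume `¬FOZ` and
`B′([−1,1])` with constant `c`.  PA(`max M 1`, `c`) gives a lattice `H·{−K₀..K₀}` with tolerance `θH ≤ ½`; V64 gives the sparsity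
constant `D`; put `δ = θH/(D+1)` and let `T₁` be the D5′-threshold for gaps `≤ δ/2`.  By `¬FOZ` pick an off-line zero `ρ₀`,
`Re ρ₀ > ½`, at height `τ ≥ T₁ + K₀H + 1` (`exists_offLine_high`).  DICHOTOMY on the sites `τ + kH`:
(A) every site carries an ON-LINE zero within `θH`: these zeros are pairwise different (`2θ < 1`), PA synthesises `2 sinh(κu)`
(`κ = Re ρ₀ − ½`) with `cost + c·Σ|b|² < 2c/M ≤ 2c/m`, and T7a (amplitudes `m·b_k`) puts an eigenvalue of a deep truncation in
`(−c,0)` — contradiction; (B) some site `s` is a HOLE: the `D+1` probes `s − θH + (2i+1)δ` each carry a zero within `δ/2` (D5′), these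
are pairwise `≥ δ` apart, within `θH − δ/2 < θH` of `s`, hence OFF-LINE, and (reflected to `Re > ½`) form `D+1` right-of-line zeros
within `½` of `s` — contradicting V64.  [new; cell theorem; CONDITIONAL only on its two displayed hypotheses] -/
theorem synthesisScreening_of (hgap : ZeroOrdinateGapsShrink) (hPA : NearLatticeSynthesis) : SynthesisScreening := by
  intro hBM hnotfoz hB
  obtain ⟨M, hM⟩ := id hBM
  obtain ⟨c, hc, N₀, hN₀⟩ := id hB
  -- multiplicity cap `M' ≥ 1`
  obtain ⟨M', hMM', hM'1⟩ : ∃ M' : ℕ, M ≤ M' ∧ 1 ≤ M' := ⟨max M 1, le_max_left _ _, le_max_right _ _⟩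
  have hM'pos : 0 < M' := hM'1
  have hM'posR : (0 : ℝ) < M' := by exact_mod_cast hM'pos
  have hMM'R : (M : ℝ) ≤ M' := by exact_mod_cast hMM'
  -- the ζ-free synthesis data (PA)
  obtain ⟨K₀, H, θ, hH, hθ, hθhalf, hθH, hPA'⟩ := hPA M' c hM'pos hc
  -- the sparsity constant (V64 + BM_off)
  obtain ⟨D, hD⟩ := offLine_sparse_of_boundedAway_of_obm hB hBM
  -- scales `δ = θH/(D+1)`, gap tolerance `δ/2`
  have hD1 : (0 : ℝ) < D + 1 := by positivity
  have hθHpos : 0 < θ * H := mul_pos hθ hH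
  obtain ⟨δ, hδdef⟩ : ∃ δ : ℝ, δ = θ * H / (D + 1) := ⟨_, rfl⟩
  have hδ : 0 < δ := by rw [hδdef]; exact div_pos hθHpos hD1
  have hδD : δ * (D + 1) = θ * H := by rw [hδdef]; exact div_mul_cancel₀ _ hD1.ne'
  obtain ⟨T₁, hT₁⟩ := hgap (δ / 2) (by positivity)
  -- a HIGH off-line zero, right of the line (¬FOZ)
  obtain ⟨ρ₀, hρ₀, hre₀, him₀⟩ := exists_offLine_high hnotfoz (T₁ + K₀ * H + 1)
  obtain ⟨_, h0lt, hlt1⟩ := mem_riemannZetaNontrivialZeros_iff_holds.1 hρ₀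
  obtain ⟨τ, hτdef⟩ : ∃ τ : ℝ, τ = ρ₀.im := ⟨_, rfl⟩
  rw [← hτdef] at him₀
  obtain ⟨κ, hκdef⟩ : ∃ κ : ℝ, κ = ρ₀.re - 1 / 2 := ⟨_, rfl⟩
  have hκ : |κ| < 1 / 2 := by rw [hκdef, abs_lt]; constructor <;> linarith
  -- THE DICHOTOMY: every lattice site `τ + kH` (`|k| ≤ K₀`) has an ON-LINE zero within `θH`, or some site is a hole
  by_cases hA : ∀ k ∈ Finset.Icc (-(K₀ : ℤ)) K₀, ∃ ρ ∈ ZetaZeros.riemannZetaNontrivialZeros,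
      ρ.re = 1 / 2 ∧ |ρ.im - (τ + k * H)| ≤ θ * H
  · /- CASE A (near-lattice): ON-LINE helpers at the sites; synthesise `2m·sinh(κu)` by PA and screen by T7a. -/
    choose! z hz using hA
    set S : Finset ℤ := Finset.Icc (-(K₀ : ℤ)) K₀ with hSdef
    have hlam : ∀ k ∈ S, |((z k).im - τ) - k * H| ≤ θ * H := by
      intro k hk
      rw [show (z k).im - τ - k * H = (z k).im - (τ + k * H) by ring]
      exact (hz k hk).2.2
    obtain ⟨b, hb⟩ := hPA' κ hκ (fun k ↦ (z k).im - τ) hlam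
    have hb' : (∫ u in Icc (-1 : ℝ) 1, ‖2 * (Real.sinh (κ * u) : ℂ) -
        ∑ k ∈ S, b k * cexp (-(I * (((z k).im - τ : ℝ) : ℂ) * u))‖ ^ 2) + c * ∑ k ∈ S, ‖b k‖ ^ 2 <
        2 * c / M' := hb
    -- a truncation level beyond `N₀` containing `ρ₀` and all the helper zeros
    obtain ⟨R, hR0, hRsum⟩ : ∃ R : ℝ, ‖ρ₀ - 1 / 2‖ ≤ R ∧ ∀ k ∈ S, ‖z k - 1 / 2‖ ≤ R := by
      refine ⟨‖ρ₀ - 1 / 2‖ + ∑ k ∈ S, ‖z k - 1 / 2‖, ?_, fun k hk ↦ ?_⟩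
      · have := Finset.sum_nonneg fun l (_ : l ∈ S) ↦ norm_nonneg (z l - 1 / 2)
        linarith
      · have h1 : ‖z k - 1 / 2‖ ≤ ∑ l ∈ S, ‖z l - 1 / 2‖ :=
          Finset.single_le_sum (fun l _ ↦ norm_nonneg (z l - 1 / 2)) hk
        have h2 : 0 ≤ ‖ρ₀ - 1 / 2‖ := norm_nonneg _
        linarith
    obtain ⟨N, hN₀N, hRN⟩ : ∃ N : ℕ, N₀ ≤ N ∧ R ≤ N :=
      ⟨max N₀ ⌈R⌉₊, le_max_left _ _, (Nat.le_ceil R).trans (by exact_mod_cast le_max_right N₀ ⌈R⌉₊)⟩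
    -- slots: `j₀` for `ρ₀`, `f k` for the helper `z k`
    obtain ⟨i₀, hi₀⟩ := exists_slot hρ₀
    have hi₀N : i₀ ∈ truncIdx N := mem_truncIdx_of_le (by rw [hi₀]; exact hR0.trans hRN)
    obtain ⟨j₀, hj₀val⟩ : ∃ j₀ : truncIdx N, ((j₀ : truncIdx N) : ZeroIdx).val = ρ₀ := ⟨⟨i₀, hi₀N⟩, hi₀⟩
    have hj : ((j₀ : truncIdx N) : ZeroIdx).OffLine := by
      show ((j₀ : truncIdx N) : ZeroIdx).val.re ≠ 1 / 2
      rw [hj₀val]; exact hre₀.ne'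
    have hslots : ∀ k ∈ S, ∃ i : ZeroIdx, i.val = z k := fun k hk ↦ exists_slot (hz k hk).1
    choose zi hzi using hslots
    have hziN : ∀ k (hk : k ∈ S), zi k hk ∈ truncIdx N := fun k hk ↦
      mem_truncIdx_of_le (by rw [hzi k hk]; exact (hRsum k hk).trans hRN)
    obtain ⟨f, hfval⟩ : ∃ f : ℤ → truncIdx N, ∀ k ∈ S, ((f k : truncIdx N) : ZeroIdx).val = z k :=
      ⟨fun k ↦ if hk : k ∈ S then ⟨zi k hk, hziN k hk⟩ else j₀, fun k hk ↦ by
        simp only [dif_pos hk]; exact hzi k hk⟩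
    have hon : ∀ k ∈ S, ¬ ((f k : truncIdx N) : ZeroIdx).OffLine := fun k hk h ↦
      h (by rw [hfval k hk]; exact (hz k hk).2.1)
    have hinj : ∀ k ∈ S, ∀ l ∈ S,
        ((f k : truncIdx N) : ZeroIdx).val = ((f l : truncIdx N) : ZeroIdx).val → k = l := by
      intro k hk l hl hkl
      rw [hfval k hk, hfval l hl] at hkl
      have h1 := (hz k hk).2.2
      have h2 := (hz l hl).2.2
      have hxy : ((k : ℝ) - l) * H = ((z l).im - (τ + l * H)) - ((z k).im - (τ + k * H)) := by rw [hkl]; ring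
      have h3 : |((k : ℝ) - l) * H| ≤ θ * H + θ * H := by
        rw [hxy]; exact (abs_sub _ _).trans (add_le_add h2 h1)
      rw [abs_mul, abs_of_pos hH] at h3
      have h4 : |(k : ℝ) - l| * H < 1 * H := by nlinarith [abs_nonneg ((k : ℝ) - l)]
      exact int_eq_of_abs_sub_lt_one (by simpa using lt_of_mul_lt_mul_right h4 hH.le)
    -- amplitudes `a_k = m·b_k`, `m` = class multiplicity of `ρ₀` (`1 ≤ m ≤ M ≤ M'`)
    have hm1 : (1 : ℝ) ≤ (fib j₀).card := by exact_mod_cast fib_card_pos j₀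
    have hmM : ((fib j₀).card : ℝ) ≤ M' := by
      have h1 := card_fib_le_order j₀
      rw [hj₀val] at h1
      have h2 : ((riemannZetaZeroOrder ρ₀ : ℤ) : ℝ) ≤ M := by exact_mod_cast hM ρ₀ hρ₀ hre₀.ne'
      exact h1.trans (h2.trans hMM'R)
    have hkap : kap j₀ = κ := by rw [hκdef, kap, hj₀val]
    have htau : ∀ k ∈ S, tau (f k) - tau j₀ = (z k).im - τ := by
      intro k hk; rw [tau, tau, hfval k hk, hj₀val, hτdef]
    have hcost : (∫ u in Icc (-1 : ℝ) 1, ‖F N (synthVec j₀ S f (fun k ↦ ((fib j₀).card : ℂ) * b k)) u‖ ^ 2) +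
        c * ∑ k ∈ S, ‖((fib j₀).card : ℂ) * b k‖ ^ 2 < 2 * c * (fib j₀).card := by
      rw [cost_synthVec_scaled S hon b]
      have hI : (fun u : ℝ ↦ ‖2 * (Real.sinh (kap j₀ * u) : ℂ) -
          ∑ k ∈ S, b k * cexp (-(I * ((tau (f k) - tau j₀ : ℝ) : ℂ) * u))‖ ^ 2) =
          fun u : ℝ ↦ ‖2 * (Real.sinh (κ * u) : ℂ) -
            ∑ k ∈ S, b k * cexp (-(I * (((z k).im - τ : ℝ) : ℂ) * u))‖ ^ 2 := by
        funext u
        rw [hkap, Finset.sum_congr rfl fun k hk ↦ by rw [htau k hk]]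
      rw [hI]
      have hnorm : ∑ k ∈ S, ‖((fib j₀).card : ℂ) * b k‖ ^ 2 = ((fib j₀).card : ℝ) ^ 2 * ∑ k ∈ S, ‖b k‖ ^ 2 := by
        rw [Finset.mul_sum]
        exact Finset.sum_congr rfl fun k _ ↦ by rw [norm_mul, Complex.norm_natCast, mul_pow]
      rw [hnorm]
      have hm2 : (0 : ℝ) < ((fib j₀).card : ℝ) ^ 2 := by positivity
      have h1 := mul_lt_mul_of_pos_left hb' hm2
      have hdiv : ((fib j₀).card : ℝ) / M' ≤ 1 := (div_le_one hM'posR).2 hmM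
      have h2 : ((fib j₀).card : ℝ) ^ 2 * (2 * c / M') = 2 * c * (fib j₀).card * ((fib j₀).card / M') := by ring
      have h3 : (0 : ℝ) ≤ 2 * c * (fib j₀).card := by positivity
      have h4 := mul_le_mul_of_nonneg_left hdiv h3
      rw [mul_add, h2] at h1
      linarith
    obtain ⟨μ, hμ, hμim, hμlo, hμhi⟩ := synth_negRoot hj S hon hinj (fun k ↦ ((fib j₀).card : ℂ) * b k) hc hcost
    exact absurd (hN₀ N hN₀N μ hμ hμim hμhi) (not_le.2 hμlo)
  · /- CASE B (a HOLE at the site `s = τ + kH`): `D+1` distinct off-line zeros within `½` of `s`, contradicting V64. -/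
    push Not at hA
    obtain ⟨k, hk, hhole⟩ := hA
    obtain ⟨s, hsdef⟩ : ∃ s : ℝ, s = τ + k * H := ⟨_, rfl⟩
    rw [← hsdef] at hhole
    have hk1 : (-(K₀ : ℝ)) ≤ k := by exact_mod_cast (Finset.mem_Icc.1 hk).1
    -- probes `T_i = s − θH + (2i+1)δ`
    obtain ⟨T, hT⟩ : ∃ T : ℕ → ℝ, ∀ i, T i = s - θ * H + (2 * i + 1) * δ := ⟨_, fun _ ↦ rfl⟩
    have hge : ∀ i : ℕ, T₁ ≤ T i := by
      intro i
      have h1 : (0 : ℝ) ≤ (2 * i + 1) * δ := by positivity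
      have h2 : -(K₀ : ℝ) * H ≤ k * H := mul_le_mul_of_nonneg_right hk1 hH.le
      rw [hT i, hsdef]
      linarith
    choose w hw using fun i : ℕ ↦ hT₁ (T i) (hge i)
    -- the probes' zeros lie within `θH − δ/2` of `s`: inside the hole, hence OFF-LINE …
    have hTs : ∀ i : ℕ, i ≤ D → |T i - s| ≤ θ * H - δ := by
      intro i hi
      have hi' : (i : ℝ) ≤ D := by exact_mod_cast hi
      have h1 : (0 : ℝ) ≤ i * δ := by positivity
      have h2 : (i : ℝ) * δ ≤ D * δ := mul_le_mul_of_nonneg_right hi' hδ.le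
      rw [hT i, abs_le]
      constructor <;> linarith
    have hws : ∀ i : ℕ, i ≤ D → |(w i).im - s| ≤ θ * H - δ / 2 := by
      intro i hi
      have := abs_sub_le (w i).im (T i) s
      linarith [hTs i hi, (hw i).2]
    have hwoff : ∀ i : ℕ, i ≤ D → (w i).re ≠ 1 / 2 := by
      intro i hi hre
      have := hhole (w i) (hw i).1 hre
      linarith [hws i hi]
    -- … and pairwise `≥ δ` apart, hence with DISTINCT ordinates
    have hwinj : ∀ i j : ℕ, i ≤ D → j ≤ D → (w i).im = (w j).im → i = j := by
      intro i j hi hj hij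
      by_contra hne
      have h1 : (1 : ℝ) ≤ |(i : ℝ) - j| := by
        rcases Nat.lt_or_gt_of_ne hne with h | h
        · have : (i : ℝ) + 1 ≤ j := by exact_mod_cast h
          rw [abs_sub_comm, abs_of_nonneg (by linarith)]; linarith
        · have : (j : ℝ) + 1 ≤ i := by exact_mod_cast h
          rw [abs_of_nonneg (by linarith)]; linarith
      have h2 : |T i - T j| = 2 * δ * |(i : ℝ) - j| := by
        rw [hT i, hT j, show s - θ * H + (2 * i + 1) * δ - (s - θ * H + (2 * j + 1) * δ) = 2 * δ * ((i : ℝ) - j) by ring,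
          abs_mul, abs_of_pos (by positivity : (0 : ℝ) < 2 * δ)]
      have h3 : |T i - T j| ≤ δ := by
        have e1 := (hw i).2
        have e2 := (hw j).2
        rw [hij] at e1
        have e1' : |T i - (w j).im| ≤ δ / 2 := by rw [abs_sub_comm]; exact e1
        linarith [abs_sub_le (T i) (w j).im (T j)]
      have h4 := mul_le_mul_of_nonneg_left h1 (by positivity : (0 : ℝ) ≤ 2 * δ)
      linarith
    -- reflect into the right half-strip (same ordinate)
    obtain ⟨r, hr⟩ : ∃ r : ℕ → ℂ, ∀ i : ℕ, i ≤ D →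
        r i ∈ ZetaZeros.riemannZetaNontrivialZeros ∧ 1 / 2 < (r i).re ∧ (r i).im = (w i).im := by
      refine ⟨fun i ↦ if 1 / 2 < (w i).re then w i else 1 - conj (w i), fun i hi ↦ ?_⟩
      by_cases hc' : 1 / 2 < (w i).re
      · beta_reduce; rw [if_pos hc']; exact ⟨(hw i).1, hc', rfl⟩
      · beta_reduce; rw [if_neg hc']
        refine ⟨ZeroIdx.one_sub_conj_mem (hw i).1, ?_, by simp⟩
        have hlt : (w i).re < 1 / 2 := lt_of_le_of_ne (not_lt.1 hc') (hwoff i hi)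
        simp only [Complex.sub_re, Complex.one_re, Complex.conj_re]
        linarith
    have hiD : ∀ i ∈ Finset.range (D + 1), i ≤ D := fun i hi ↦ Nat.lt_succ_iff.1 (Finset.mem_range.1 hi)
    have hcard : ((Finset.range (D + 1)).image r).card = D + 1 := by
      rw [Finset.card_image_of_injOn, Finset.card_range]
      intro i hi j hj hij
      have hi' : i ≤ D := hiD i (Finset.mem_coe.1 hi)
      have hj' : j ≤ D := hiD j (Finset.mem_coe.1 hj)
      have him : (r i).im = (r j).im := by rw [hij]
      rw [(hr i hi').2.2, (hr j hj').2.2] at him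
      exact hwinj i j hi' hj' him
    have hTT : ∀ ρ ∈ (Finset.range (D + 1)).image r,
        ρ ∈ ZetaZeros.riemannZetaNontrivialZeros ∧ 1 / 2 < ρ.re ∧ |ρ.im - s| ≤ 1 / 2 := by
      intro ρ hρ
      obtain ⟨i, hi, rfl⟩ := Finset.mem_image.1 hρ
      have hi' : i ≤ D := hiD i hi
      refine ⟨(hr i hi').1, (hr i hi').2.1, ?_⟩
      rw [(hr i hi').2.2]
      linarith [hws i hi']
    have hle := hD s _ hTT
    omega

end Summit.RiemannHypothesis.RiemannHypothesis.Theorems.Splittings.BombieriTruncSynthesisScreening
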